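import Summits.Ventures.Crystal3D.Theorems.StickyWulffConstantStackingLiminfPlateauHeight
import Summits.Ventures.Crystal3D.Theorems.StickyWulffConstantStackingLiminfRungBumpMass
import Summits.Ventures.Crystal3D.Theorems.StickyWulffConstantStackingLiminfRungEtaMass
import HarnessLib

/-!
# Rung R6 of line `LayerChain` v4 (crux `StackingLiminf`, stmt-Ventures-19145): the PLATEAU HEIGHT —
# the doubly mollified density of a Barlow configuration never exceeds `1 + ε` once `K ≥ K₀(ε)`

Route `StickyWulffConstant` of the venture `Summits/Ventures/Crystal3D` (cell `crystal3d-full`).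
`rung_smooth_le_one_add` is the planner's rung R6 (`HOME/cf-p1/route/lines/LayerChainV4Rungs.lean`,
evidence #23 on stmt-Ventures-19145) VERBATIM: for every `ε > 0` there is `K₀` such that for every
Hägg word `σ`, every injective configuration `x` inside `barlowStacking 1 √(2/3) σ`, all scales
`K₀ ≤ K ≤ L` and every point `y`, `smooth x K L y ≤ 1 + ε`.  Assembly of
* `dens_le_sqrt_two_mul_integral_bump_add` (eng, p510655): `dens x K y ≤ √2 ∫φ_K + 2592√2·bumpConst/K`,
* `rung_integral_bump` (wulff-p2, p507991): `∫ φ_K = 1/√2`,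
* `smooth_le_mul_integral_eta` (p510655) and `rung_integral_eta` (wulff-p2, p507748): `∫ η_L = 1`,
with `K₀ = max 1 (2592 √2 · bumpConst / ε)`.  This is the upper-height input of stub (C)
`stub_plateauBound`.  (The Hägg hypothesis is not used: the bound holds for every letter sequence.)
WHAT THIS IS NOT: stub (C); rung F-C1 not moved.
-/

noncomputable section

namespace Summit.Ventures.Crystal3D.Theorems

open MeasureTheory
open Literature.MathematicalPhysics.StatisticalMechanics (IsHaggSeq barlowStacking)
open Summit.Ventures.Crystal3D.Cruxes.StackingLiminf.LayerChainV4 (bump bumpConst dens eta smooth)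
open Summit.Ventures.Crystal3D.Theorems.PlateauHeight

/-- **Rung R6 (plateau height).**  `∀ ε > 0, ∃ K₀, ∀` Hägg `σ`, injective `x ⊂ barlowStacking 1 √(2/3) σ`,
`K₀ ≤ K ≤ L`, `y`: `smooth x K L y ≤ 1 + ε`. -/
theorem rung_smooth_le_one_add : ∀ ε : ℝ, 0 < ε → ∃ K₀ : ℝ, ∀ (N : ℕ) (σ : ℤ → ℤ), IsHaggSeq σ →
    ∀ x : Fin N → EuclideanSpace ℝ (Fin 3), Function.Injective x →
      (∀ i, x i ∈ barlowStacking 1 (Real.sqrt (2 / 3)) σ) →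
        ∀ K L : ℝ, K₀ ≤ K → K ≤ L → ∀ y, smooth x K L y ≤ 1 + ε := by
  intro ε hε
  have hb : 0 < bumpConst := bumpConst_pos
  have hr2 : 0 < Real.sqrt 2 := Real.sqrt_pos.2 (by norm_num)
  refine ⟨max 1 (2592 * Real.sqrt 2 * bumpConst / ε), ?_⟩
  intro N σ _ x hx hmem K L hK hKL y
  have hK1 : 1 ≤ K := le_trans (le_max_left _ _) hK
  have hK0 : 0 < K := by linarith
  have hL0 : 0 < L := by linarith
  have hKε : 2592 * Real.sqrt 2 * bumpConst / ε ≤ K := le_trans (le_max_right _ _) hK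
  -- height of the `K`-mollified density
  have hdens : ∀ y', dens x K y' ≤ 1 + ε := by
    intro y'
    have h := dens_le_sqrt_two_mul_integral_bump_add σ x hx hmem hK1 y'
    rw [rung_integral_bump K hK0] at h
    have e : Real.sqrt 2 * (1 / Real.sqrt 2) = 1 := by field_simp
    rw [e] at h
    have herr : 2592 * Real.sqrt 2 * bumpConst / K ≤ ε := by
      rw [div_le_iff₀ hK0]
      rw [div_le_iff₀ hε] at hKε
      linarith
    linarith
  -- lateral averaging
  have h := smooth_le_mul_integral_eta x hL0 hdens y
  rwa [rung_integral_eta L hL0, mul_one] at h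

end Summit.Ventures.Crystal3D.Theorems

end
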